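import Literature.Analysis.Fourier.RadialSchwartzInterpolationThm31Two
import HarnessLib

/-!
# The CKMRV interpolation theorem (Theorem 1.7): decomposition into the generating functions

Topic `Literature/Analysis/Fourier`. SPLIT of the named fact
`Literature.Analysis.Fourier.CKMRV2022_interpolationFormula` (`RadialSchwartzInterpolation.lean`;
Cohn–Kumar–Miller–Radchenko–Viazovska, Ann. of Math. 196 (2022), Theorem 1.7: radial Schwartz
interpolation bases with nodes `√(2n)` exist for `(d, n₀) = (8, 1)` and `(24, 2)`) along the
printed organisation of its proof (§1.6: "Section 3 shows how to reduce the interpolation theorem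
to the existence of generating functions"; §5.2: "The interpolation formula will follow from
Theorem 3.1 once we verify all the latter's hypotheses"):

* Theorem 3.1 (functional equations ⇒ interpolation formula), INCLUDING its last clause
  (`o(e^{−2π Im τ})` ⇒ `n₀ = 2`), is a theorem of the tree
  (`isInterpolationBasis_of_generatingFunctions`, `isInterpolationBasis_two_of_generatingFunctions`,
  `RadialSchwartzInterpolationThm31*.lean`, resting on steps 1–8 in the sibling files), assembled
  in `ckmrv2022_interpolationFormula_of_generatingFunctions`;
* what remains are the generating functions `F, F̃` of §§4–5 of the source (the Laplace
  transforms (§4.1) of the modular-form kernels `𝒦, 𝒦_±` of Theorem 4.3, continued to `ℍ` in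
  Proposition 5.1 / Corollary 5.2, with the growth estimates of §5.2), in dimension
  `8` and in dimension `24`. These are the two children below, stated verbatim as the hypotheses
  `h8`, `h24` of that assembly: `CKMRV2022_generatingFunctions_dim8`,
  `CKMRV2022_generatingFunctions_dim24`;

and the PROVED assembly `CKMRV2022_interpolationFormula_holds_of`.

## References

* H. Cohn, A. Kumar, S. D. Miller, D. Radchenko, M. Viazovska, *Universal optimality of the `E₈`
  and Leech lattices and interpolation formulas*, Ann. of Math. 196 (2022) 983–1082,
  arXiv:1902.05438: §1.6, §3.1 (Theorem 3.1), §4.1 (Theorem 4.3 and the Laplace-transform formula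
  for `F`), §5.1 (Proposition 5.1, Corollary 5.2), §5.2 (proof of Theorem 1.7). [CohnEtAl2019]
-/

noncomputable section

open scoped Topology UpperHalfPlane Manifold Real SchwartzMap ContDiff FourierTransform
open Filter Complex UpperHalfPlane Function MeasureTheory Set

namespace Literature.Analysis.Fourier

/-! ## The children (named facts) -/

/-- NAMED FACT (CKMRV 2022, §§4–5 in dimension `8`: the generating functions of Theorem 3.1
exist). There are functions `F, F̃ : ℍ × ℝ⁸ → ℂ` (curried `ℍ → ℝ⁸ → ℂ`) which satisfy the
hypotheses (1), (3), (4), (5) of CKMRV Theorem 3.1 (`IsGeneratingFamily`: smooth fibres with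
jointly continuous `x`-derivatives, holomorphic in `τ`, the growth bounds (3) in Fréchet form,
`|F(τ,x)| ≤ α Im(τ)^{−β}` on `|Re τ| ≤ 1`, and `F(τ+2,x) − 2F(τ+1,x) + F(τ,x) = 0`), are radial in
`x` (hypothesis (2)), and satisfy the first functional equation of (5),
`F(τ,x) + (i/τ)⁴ F̃(−1/τ,x) = e^{πiτ|x|²}`.  In the source `F = F^{(8)}` is the Laplace transform
(§4.1) of the kernel `𝒦^{(8)}` of Theorem 4.3 (built from weakly holomorphic quasimodular forms
for `Γ(2)` and `log λ`), continued from `𝒟` to `ℍ` by Proposition 5.1 / Corollary 5.2, with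
`F̃ = (e^{πiτ|x|²} − F)|_{4}S`; the hypotheses are verified in §5.2 (with the bound
`F^{(8)}, F̃^{(8)} = O(|τ|^A e^{−π Im τ})` on the strip). This is
hypothesis `h8` of `ckmrv2022_interpolationFormula_of_generatingFunctions` verbatim. Users take
`(h : CKMRV2022_generatingFunctions_dim8)`.
[cite: CohnEtAl2019, §4.1 Theorem 4.3, §5.1 Proposition 5.1 and Corollary 5.2, §5.2 (proof of Theorem 1.7, d = 8)] -/
def CKMRV2022_generatingFunctions_dim8 : Prop :=
  ∃ F Ft : ℍ → EuclideanSpace ℝ (Fin 8) → ℂ, IsGeneratingFamily F ∧ IsGeneratingFamily Ft ∧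
    (∀ τ, IsRadial (F τ)) ∧ (∀ τ, IsRadial (Ft τ)) ∧
    ∀ (τ : ℍ) (x : EuclideanSpace ℝ (Fin 8)), F τ x + (Complex.I / (τ : ℂ)) ^ (((8 : ℕ) : ℂ) / 2) *
      Ft (UpperHalfPlane.negInv τ) x = cexp (π * Complex.I * (τ : ℂ) * ‖x‖ ^ 2)

/-- NAMED FACT (CKMRV 2022, §§4–5 in dimension `24`: the generating functions of Theorem 3.1
exist and are `o(e^{−2π Im τ})`). There are functions `F, F̃ : ℍ × ℝ²⁴ → ℂ` which satisfy the
hypotheses (1), (3), (4), (5) of CKMRV Theorem 3.1 (`IsGeneratingFamily`), are radial in `x`, are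
`o(e^{−2π Im τ})` as `Im τ → ∞` in the strip `|Re τ| ≤ 1` for each fixed `x` (`IsLittleOExpAt`; the
source proves the stronger `F^{(24)}, F̃^{(24)} = O(|τ|^A e^{−3π Im τ})` (§5.2), "which allows us to
deduce `n₀ = 2` in `d = 24` dimensions"), and satisfy
`F(τ,x) + (i/τ)^{12} F̃(−1/τ,x) = e^{πiτ|x|²}`.  In the source `F = F^{(24)}` is the Laplace
transform (§4.1) of the kernel `𝒦^{(24)}` of Theorem 4.3, continued to `ℍ` by Proposition 5.1 /
Corollary 5.2. This is hypothesis `h24` of `ckmrv2022_interpolationFormula_of_generatingFunctions`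
verbatim. Users take `(h : CKMRV2022_generatingFunctions_dim24)`.
[cite: CohnEtAl2019, §4.1 Theorem 4.3, §5.1 Proposition 5.1 and Corollary 5.2, §5.2 (proof of Theorem 1.7, d = 24, n₀ = 2)] -/
def CKMRV2022_generatingFunctions_dim24 : Prop :=
  ∃ F Ft : ℍ → EuclideanSpace ℝ (Fin 24) → ℂ, IsGeneratingFamily F ∧ IsGeneratingFamily Ft ∧
    (∀ τ, IsRadial (F τ)) ∧ (∀ τ, IsRadial (Ft τ)) ∧
    (∀ x, IsLittleOExpAt F x) ∧ (∀ x, IsLittleOExpAt Ft x) ∧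
    ∀ (τ : ℍ) (x : EuclideanSpace ℝ (Fin 24)), F τ x + (Complex.I / (τ : ℂ)) ^ (((24 : ℕ) : ℂ) / 2) *
      Ft (UpperHalfPlane.negInv τ) x = cexp (π * Complex.I * (τ : ℂ) * ‖x‖ ^ 2)

/-! ## The assembly (proved) -/

/-- **CKMRV Theorem 1.7 from the generating functions (SPLIT assembly).** The existence of the
generating functions in dimensions `8` and `24` (`CKMRV2022_generatingFunctions_dim8`,
`CKMRV2022_generatingFunctions_dim24`) implies `CKMRV2022_interpolationFormula`, by CKMRV
Theorem 3.1, which is proved in the tree (`ckmrv2022_interpolationFormula_of_generatingFunctions`).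
[cite: CohnEtAl2019, §3.1 Theorem 3.1 and §5.2 (proof of Theorem 1.7)] -/
theorem CKMRV2022_interpolationFormula_holds_of (h₈ : CKMRV2022_generatingFunctions_dim8)
    (h₂₄ : CKMRV2022_generatingFunctions_dim24) : CKMRV2022_interpolationFormula :=
  ckmrv2022_interpolationFormula_of_generatingFunctions h₈ h₂₄

end Literature.Analysis.Fourier
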